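import Summits.NavierStokesRegularity.NavierStokesRegularity.Theses.TypeILiouville
import Summits.NavierStokesRegularity.NavierStokesRegularity.Theses.ExtremalTypeIConstant
import Literature.Analysis.FluidPDE.LocalTypeI
import Literature.Analysis.FluidPDE.TypeIAncientMild
import HarnessLib

/-!
# `TypeIliouvilleNoTypeII` (stmt-NavierStokesRegularity-0056) — line `eternal-split`
# (crux-strategist, generation s2, bet route `ExtremalTypeIConstant`, 2026-08-17), registered skeleton

The crux (`NoTypeII`; `TypeILiouville.TypeIliouvilleNoTypeII` = `ExtremalTypeIConstant.NoTypeII`, same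
term): a maximal smooth solution on `ℝ³ × [0, T)`, Leray–Hopf from a rapidly decaying datum, blows up
at the sup-norm Type-I rate `‖u(t)‖_∞ ≤ C/√(T − t)`.

THE LINE IS A GENUINE DICHOTOMY, NOT A BYPASS.  The live line `energy_split` (gen p1) cuts the
Type-I/Type-II dichotomy in the ENERGY sense (`𝐈 < ∞`, Seregin / Albritton–Barker) and then proves the
crux VACUOUSLY: its stub 2 (`NoLocalTypeISingularity` = stmt-10480, of (L)-strength) forbids every
energy-Type-I singular point, so under its stubs no blow-up exists at all — it pays, on the Type-I side,
for the exclusion of sup-rate Type-I blow-ups, which the crux never asks for and which the sup-rate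
consumers (ExtremalTypeIConstant, SqueezeCycle, SymmetryModuliCount: X = (L′) in the KNSS gauge) exclude
THEMSELVES through `LiouvilleKillsTypeI`.  This line keeps the energy cut on the Type-II side (stub 1, the
residual) but argues by contradiction from `¬ IsTypeIBlowup u T` (stub 2): at the points where
`√(T − t)‖u(t)‖_∞` is unbounded, the time-doubling / near-maximum zoom of the dead line `immortal-zoom`
(LANDED: `stub_timeDoubling` p136683, `stub_activeWindowsZoomTools`, `stub_activeWindowsGenerateNonconstant`,
`Theorems/TypeILiouvilleTypeIliouvilleNoTypeII{StubTimeDoubling,StubActiveWindowsZoom,StubActiveWindows}.lean`)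
produces a bounded ETERNAL Oseen-mild solution `v` on `ℝ × ℝ³`, `‖v‖ ≤ 2`, `v(0,0) ≠ 0`; the NEW input is
that the zoom windows sit inside the energy-Type-I slab of stub 1, so Albritton–Barker's scale-invariant
quantity is inherited: `𝐈(v; ℝ × ℝ³) < ∞` (scale invariance + lower semicontinuity, Seregin 2014 §6.3
p. 114 "the same type of quantities will be bounded for the ancient solution"; tree `LocalTypeILsc*`).
Stub 3 is the Liouville theorem for exactly that class.  What `𝐈 < ∞` buys, and why this is not
`immortal-zoom` again: (i) NON-DEGENERACY FOR FREE — constants / uniform streams have `𝐈 = ∞`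
(`A(Q_r) ~ r²`), so the depletion-to-a-stream death of `stub_windowActivity` (row 1 of the p1 wall) cannot
occur and no "activity" stub is needed; (ii) the eternal Liouville residual EXCLUDES the open steady
problem that killed `stub_eternalLiouville` ("bounded steady flows are constant", KNSS 2009 p. 9): for a
steady field `E(Q(z,r)) = r ∫_{B_r} |∇v|² ≤ 𝐈` forces `∫_{ℝ³} |∇v|² = 0`, one line.  Stub 3 is strictly
weaker than (L) (tree: `stub_eternalLiouville_of_liouvilleConjecture` + constants have `𝐈 = ∞`) and than
energy_split's stub 2 (an eternal element restricts to a nontrivial mild bounded ancient one with `𝐈 < ∞`,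
i.e. to `NontrivialMildAncientTypeIExists`).

* STUB 1 `stub_energyTypeISlab` — RESIDUAL, OPEN (Type-II side).  Every finite-energy blow-up from a
  rapidly decaying datum is Type I in the ENERGY sense of Seregin (arXiv:2304.04045 (1.1): `g < ∞`) /
  Albritton–Barker (arXiv:1811.00502 §1: `𝐈 < ∞`), uniformly over the final slab `(T − r², T) × ℝ³`.
  Implied by the crux given finite energy (A–B Lemma 2.5 with the estimate of Remark 3.2, tree fact
  `albrittonBarker2019_lemma_2_5_rate`; energy-class bounds on `C(1)`, `D(1)`); the converse is "not
  known" (A–B p. 4).  Dies with the crux under an axisymmetric blow-up (Disproof §c; Seregin 2020).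
* STUB 2 `stub_eternalProfileOfTypeII` — PROVABLE NOW (size L; KNSS 2009 §6 + Giga–Miura 2011 blow-up
  argument + A–B/Seregin inheritance of `𝐈`): energy-Type-I slab ∧ `¬ IsTypeIBlowup` ⇒ a nonzero bounded
  eternal Oseen-mild classical solution with `𝐈(ℝ × ℝ³) < ∞`.
* STUB 3 `stub_eternalEnergyLiouville` — OPEN (Type-I side, the new residual `EEL`): bounded eternal
  Oseen-mild classical solutions with `𝐈(ℝ × ℝ³) < ∞` vanish.

Composition `TypeIliouvilleNoTypeII_of` = STUB 1 → STUB 2 → STUB 3 → crux (by name), kernel-checked,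
`by_contra` on `IsTypeIBlowup u T`; corollary `extremalTypeIConstant_noTypeII_of` for the bet route's copy.
Disproof used: §a `_false_without_lerayHopf` honoured — `IsLerayHopfOn` is a binder of stubs 1–2 and is
load-bearing in both (the drift `u = g(t)e₁` has `𝐈 = ∞`; the zoom needs the sub-slab bounds); §b rate
tightness untouched (no rate is improved); §c the conditional axisymmetric kill transfers to stub 1.
-/

noncomputable section

-- the summit and its single problem share the name `NavierStokesRegularity` (D-0017 nested layout)
set_option linter.dupNamespace false

open Set Function Filter Topology MeasureTheory Metric
open scoped NNReal ENNReal

namespace Summit.NavierStokesRegularity.NavierStokesRegularity.Cruxes.TypeIliouvilleNoTypeII.EternalSplit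

open Literature.Analysis Literature.Analysis.FluidPDE

/-- `ℝ³`. -/
local notation "E3" => EuclideanSpace ℝ (Fin 3)

/-! ## Stubs -/

/-- STUB 1 — RESIDUAL, OPEN (`EnergyTypeISlab`).  Every maximal smooth solution with finite lifespan `T`,
Leray–Hopf from a rapidly decaying datum, is Type I in the ENERGY sense uniformly over a final slab:
for some `0 < r`, `r² ≤ T`, Albritton–Barker's quantity `𝐈((T − r², T) × ℝ³) = sup (A + C + D + E)(Q')`
over all backward parabolic balls `Q' ⊆ (T − r², T) × ℝ³` is finite (`∇u` = `fderiv`).  Weaker than the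
crux given finite energy (A–B Lemma 2.5 / Remark 3.2 with its estimate in `C(1)`, `D(1)`; Seregin 2014
Prop. 3.11 (i)); converse not known (A–B 2019 p. 4). -/
theorem stub_energyTypeISlab (ν T : ℝ) (hν : 0 < ν) (hT : 0 < T) (u : ℝ → E3 → E3)
    (p : ℝ → E3 → ℝ) (hmax : IsMaximalSmoothSolution ν 0 u p T)
    (hLH : IsLerayHopfOn T ν 0 (u 0) u) (hdec : HasRapidSpatialDecay (u 0)) :
    ∃ r : ℝ, 0 < r ∧ r ^ 2 ≤ T ∧
      typeIBound (Ioo (T - r ^ 2) T ×ˢ (univ : Set E3)) u p (fun t y => fderiv ℝ (u t) y) < ⊤ := by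
  sorry

/-- STUB 2 — PROVABLE NOW (`EternalProfileOfTypeII`, size L).  If such a solution is energy-Type-I on a
final slab but NOT Type I in the sup-norm sense, then zooming at the time-doubling near-maxima where
`√(T − t)‖u(t)‖_∞ → ∞` (tree: `stub_timeDoubling`, `stub_activeWindowsZoomTools`,
`stub_activeWindowsGenerateNonconstant`; KNSS 2009 §6, Giga–Miura 2011) yields a bounded ETERNAL solution:
jointly smooth on `ℝ × ℝ³`, divergence free, Oseen-mild between all pairs of times (unit viscosity),
`‖v‖ ≤ 2`, classical with some pressure `q`, nonzero at the origin, and — the windows lying inside the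
slab, by scale invariance and lower semicontinuity of `A, C, D, E` (Seregin 2014 §6.3 p. 114; tree
`LocalTypeILsc*`) — with `𝐈(ℝ × ℝ³) < ∞`. -/
theorem stub_eternalProfileOfTypeII (ν T : ℝ) (hν : 0 < ν) (hT : 0 < T) (u : ℝ → E3 → E3)
    (p : ℝ → E3 → ℝ) (hmax : IsMaximalSmoothSolution ν 0 u p T)
    (hLH : IsLerayHopfOn T ν 0 (u 0) u) (hdec : HasRapidSpatialDecay (u 0))
    (hI : ∃ r : ℝ, 0 < r ∧ r ^ 2 ≤ T ∧
      typeIBound (Ioo (T - r ^ 2) T ×ˢ (univ : Set E3)) u p (fun t y => fderiv ℝ (u t) y) < ⊤)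
    (hII : ¬ IsTypeIBlowup u T) :
    ∃ (v : ℝ → E3 → E3) (q : ℝ → E3 → ℝ),
      ContDiff ℝ (⊤ : ℕ∞) (uncurry v) ∧ (∀ t, VectorCalculus.IsDivFree (v t)) ∧
      (∀ s t : ℝ, s < t → ∀ x, v t x = heatFlow (v s) (t - s) x - oseenDuhamel 1 s v v t x) ∧
      (∀ t x, ‖v t x‖ ≤ 2) ∧ IsClassicalNSSolutionOn univ 1 0 v q ∧
      typeIBound (univ : Set (ℝ × E3)) v q (fun t y => fderiv ℝ (v t) y) < ⊤ ∧ v 0 0 ≠ 0 := by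
  sorry

/-- STUB 3 — OPEN, the new Type-I-side residual (`EternalEnergyLiouville`, "EEL").  A bounded eternal
solution of Navier–Stokes (unit viscosity) on `ℝ × ℝ³` — jointly smooth, divergence free, Oseen-mild
between all pairs of times, classical with pressure `q` — whose Albritton–Barker quantity over ALL
parabolic balls of space-time is finite, `𝐈(ℝ × ℝ³) < ∞`, vanishes identically.  Strictly below (L)
(`stub_eternalLiouville_of_liouvilleConjecture` + constants have `𝐈 = ∞`) and below
`¬ NontrivialMildAncientTypeIExists` (restrict to `t < 0`); trivially true for steady fields
(`r ∫_{B_r}|∇v|² ≤ 𝐈`); a counterexample would blow DOWN (A–B Thm 1.1, reverse direction) to a local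
Type-I singular point of a suitable weak solution. -/
theorem stub_eternalEnergyLiouville (v : ℝ → E3 → E3) (q : ℝ → E3 → ℝ)
    (hv : ContDiff ℝ (⊤ : ℕ∞) (uncurry v)) (hdiv : ∀ t, VectorCalculus.IsDivFree (v t))
    (hmild : ∀ s t : ℝ, s < t → ∀ x, v t x = heatFlow (v s) (t - s) x - oseenDuhamel 1 s v v t x)
    (hbd : ∃ C : ℝ, ∀ t x, ‖v t x‖ ≤ C) (hcl : IsClassicalNSSolutionOn univ 1 0 v q)
    (hI : typeIBound (univ : Set (ℝ × E3)) v q (fun t y => fderiv ℝ (v t) y) < ⊤) :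
    ∀ t x, v t x = 0 := by
  sorry

/-! ## Composition -/

/-- **The crux from the stubs** (`TypeIliouvilleNoTypeII`, concluded BY NAME).  For a maximal
Leray–Hopf solution from a rapidly decaying datum, suppose the sup-norm Type-I rate fails; STUB 1 gives the
energy-Type-I slab, STUB 2 turns the failure of the rate into a nonzero bounded eternal profile with
`𝐈 < ∞`, and STUB 3 makes that profile vanish — contradiction.  A genuine dichotomy: the line never excludes
blow-up, only Type-II-in-time blow-up given energy-Type-I. -/
theorem TypeIliouvilleNoTypeII_of :
    Summit.NavierStokesRegularity.NavierStokesRegularity.Theses.TypeILiouville.TypeIliouvilleNoTypeII := by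
  intro ν T hν hT u p hmax hLH hdec
  by_contra hII
  obtain ⟨v, q, hv, hdiv, hmild, hbd, hcl, hI, hv0⟩ :=
    stub_eternalProfileOfTypeII ν T hν hT u p hmax hLH hdec
      (stub_energyTypeISlab ν T hν hT u p hmax hLH hdec) hII
  exact hv0 (stub_eternalEnergyLiouville v q hv hdiv hmild ⟨2, hbd⟩ hcl hI 0 0)

/-- The bet route's copy of the crux (`ExtremalTypeIConstant.NoTypeII`, binder 4 of its `closes`) is the
same term. -/
theorem extremalTypeIConstant_noTypeII_of :
    Summit.NavierStokesRegularity.NavierStokesRegularity.Theses.ExtremalTypeIConstant.NoTypeII :=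
  TypeIliouvilleNoTypeII_of

end Summit.NavierStokesRegularity.NavierStokesRegularity.Cruxes.TypeIliouvilleNoTypeII.EternalSplit

end
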